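import Summits.QuantumFields.YangMills.Theorems.BalabanUVNodesN15KingModelGraphTreeDecayExtensive

/-!
# BalabanUVNodes ∕ N15 — THE KING-MODEL RUNG (PART Β-d): THE `K → ∞` LIMIT OF EVERY VACUUM DIAGRAM EXISTS — THEOREM 2.1 (i) (2.22)'s SHAPE «∃ lim_{κ→∞}» AND
# (ii) (2.23)'s SHAPE «≤ C|T|» FOR ONE DIAGRAM OF KING's `A = 0` MODEL, BY NAME (the Cauchy argument (3.10)–(3.13) run on part Β-a's `C·L^{−γK}·|T|`)
# (Track A, DAG node N15 = NE2; FAN-OUT v1.1 §N15 s3 «KING-MODEL RUNG … NE2's analogue DECIDED in the model»)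

HONEST FRAMING.  Count-neutral (cell `pub-ymgap`, seat `pub-ymgap-dag-n15-e` g30; `--supports stmt-QuantumFields-27366 --as helper` = K3⁸
`SpineGivenEndpointR13SepCoPHV`).  TEMPLATE LITERATURE: C. King, *The U(1) Higgs model. I. The continuum limit*, Commun. Math. Phys. **102** (1986) 649–677
[King1986]: Theorem 2.1 p. 654 and its deduction from Theorem 3.4, (3.10)–(3.13) pp. 656–657 («Hence {Z^{ε_κ}(T_{ε_κ}, g, h)} is a Cauchy sequence and
converges to a unique limit as κ → ∞») — run HERE on ONE VACUUM DIAGRAM of KING's OWN `A = 0` MODEL at fixed volume `2L^{e_M}`, mass and `a`: the sequence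
`K ↦ E^{(K)}(G)` (`K` coarse scales, torus `Tor (fine (L^K) (2L^{e_M}))`) has consecutive differences `≤ |T|·C_G·L^{−γK}` (part Β-a), hence is Cauchy.  NOT the
partition function `Z`, NOT Bałaban's `G(U)`, NOT a node discharge; nothing continuum-ℝ⁴ ∕ OS ∕ mass-gap ∕ Clay («continuum limit» here = King's `κ → ∞` at
fixed torus `T`, for one diagram's amplitude).  0 `sorry`; standard axioms.  Text layer of pp. 654–657 (`paper:king1986-cmp102-king-u1-higgs-i` p0006–p0009)
re-read by this seat 2026-08-29.

THE PRINT.  p. 654 [PDF 6], Theorem 2.1: *«For the torus T defined by (2.21) in dimensions d = 2, 3, (i) ∃ lim_{κ→∞} Z^{ε_κ}(T_{ε_κ}, g, h) = Z(T, g, h), (2.22)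
(ii) |ln Z(T, g, h)| ≤ C|T|, (2.23)»*; p. 657 [PDF 9] (3.13): *«Hence {Z^{ε_κ}(T_{ε_κ}, g, h)} is a Cauchy sequence and converges to a unique limit as κ → ∞.
The uniform bound in Theorem 2.1 is just the statement of ultra-violet stability.»*

READING (declared; ours).  Fix odd `L ≥ 3`, `a > 0`, a mass `0 < m² ≤ m₀²`, a volume exponent `e_M` and a CONNECTED numbered vacuum graph `G` (`nn + 1` vertices,
`m` lines of kinds `κ`).  `kingVacuumSeq K := E^{(K+1)}(G)` — the leg-free amplitude at `K + 1` coarse scales (index `jvSucc e_M K`, part Β-a's trivial root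
factor).  Part Β-a `king_vacuum_graph_rate_extensive` at `n = 1`: `|E^{(K+2)}(G) − E^{(K+1)}(G)| ≤ (2L^{e_M})^{d+1}·L^{−γ(K+1)}·A^{2m+nn+1}·m!·(m+1) =: C·r^K`,
`r = L^{−γ} < 1` ⇒ Mathlib's `cauchySeq_of_le_geometric` ∕ `cauchySeq_tendsto_of_complete` ∕ `dist_le_of_le_geometric_of_tendsto`: ★★★ THE LIMIT `E^{(∞)}(G)`
EXISTS and `|E^{(K+1)}(G) − E^{(∞)}(G)| ≤ C·r^K∕(1 − r)` ((2.22)'s shape with the rate); with part Β-a `king_vacuum_graph_size_extensive` ((3.77) along every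
ordering) the limit obeys ★★ `|E^{(∞)}(G)| ≤ |T|·A^{m+nn+1}·Σ_π degConst` ((2.23)'s shape `C|T|`).  §3: both with NO hypothesis for connected pseudoforests of
`G`-lines in `1 ≤ d ≤ 3`.

WHAT THIS FILE PROVES (namespace `Summit.QuantumFields.YangMills.BalabanUVNodes.N15KingModelRung.Curved`).  §1 `jvSucc`, `kingVacuumSeq` (objects),
`kingVacuumSeq_succ_sub_le` (consecutive differences are geometric).  §2 ★★★ **`king_vacuum_graph_continuumLimit`** ((2.22)'s shape + rate), ★★
**`king_vacuum_graph_limit_extensive`** ((2.23)'s shape).  §3 ★★ `king_vacuum_pseudoforest_continuumLimit`, ★★ `king_vacuum_pseudoforest_limit_extensive`.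

HONEST SCOPE.  (a) One diagram's amplitude in King's `A = 0` model at fixed volume — not `Z`, not the effective action, no `(L^kε_κ)` bookkeeping (part Β-a
HONEST SCOPE (a)); diagrams WITH LEGS are not taken to the limit here (their fine legs `kingExtHi` at index `jv` and the coarse legs `kingExtLo` at the next
index live on the carriers `L^n·L^K` vs `L^{K+n}`, equal only up to the transport `torCongr` — an identity not typed in this file).  (b) p. 664's sentence ∕ (3.77)
are the hypotheses of §2 (discharged in §3).  (c) NOT Bałaban's `G(U)`; N15 untouched; counts unmoved.
Locators: [King1986] Thm 2.1 (2.22)–(2.23) p.654, (3.10)–(3.13) pp.656–657, Thm 3.4 (3.9) p.656, Prop. 3.6 (3.56) p.662, p.664, (3.77) p.666.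
-/

noncomputable section

open scoped BigOperators Topology
open Finset Filter

namespace Summit.QuantumFields.YangMills.BalabanUVNodes.N15KingModelRung.Curved

open Literature.MathematicalPhysics.QuantumFieldTheory.Balaban1983to89.B5Prop11Plancherel (Tor fine)
open Summit.QuantumFields.YangMills.BalabanUVNodes.N15KingModelRung (KingVolIndex kingVol kingVol_neZero)
open Summit.QuantumFields.YangMills.BalabanUVNodes.N15KingModelRung.Graph

variable {d : ℕ} (L : ℕ) [NeZero L]

/-! ## §1 The objects: the vacuum amplitude along `K`, and its geometric consecutive differences -/

section Objects

omit [NeZero L] in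
/-- The index with volume exponent `e_M`, `K + 1` coarse scales and size letter `1`. [cite: King1986, (2.21) p.654 (the torus), (3.14) p.657 (η = L^{−k})] -/
def jvSucc (eM K : ℕ) : KingVolIndex d := ⟨eM, K + 1, Nat.succ_pos K, 1, le_rfl⟩

/-- **THE VACUUM AMPLITUDE ALONG `K`**: `kingVacuumSeq K = E^{(K+1)}(G) = Σ_{x_0,…,x_nn ∈ T_η} η^{(d+1)(nn+1)} Π_ℓ G^η_ℓ` (`η = L^{−(K+1)}`, torus `2L^{e_M}`; the
leg-free amplitude written with part Β-a's trivial root factor). [cite: King1986, (3.35) p.659 («vacuum energy diagrams»), (3.29) p.658] -/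
def kingVacuumSeq (a msq : ℝ) (eM nn m : ℕ) (src tgt : Fin m → Fin (nn + 1)) (κ : Fin m → Option (Fin (d + 1))) (K : ℕ) : ℝ :=
  haveI := kingVol_neZero L (jvSucc (d := d) eM K)
  graphValLS ((((L : ℝ) ^ (K + 1))⁻¹) ^ (d + 1)) src tgt (fun ℓ => kingGLine L (kingVol L (jvSucc (d := d) eM K)) a msq (K + 1) (κ ℓ))
    (fun _ : Unit => (0 : Fin (nn + 1))) (fun _ _ => (1 : ℝ))

/-- **CONSECUTIVE DIFFERENCES ARE GEOMETRIC**: with part Β-a's `(A, γ)`, for every mass, volume exponent, CONNECTED vacuum graph under p. 664's sentence and `K`: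
`|E^{(K+2)}(G) − E^{(K+1)}(G)| ≤ ((2L^{e_M})^{d+1}·L^{−γ}·A^{2m+nn+1}·m!·(m+1))·(L^{−γ})^K` — part Β-a `king_vacuum_graph_rate_extensive` at `n = 1`,
`|T^{(K)}| = (2L^{e_M})^{d+1}` (`card_unitTorus`), `L^{−γ(K+1)} = L^{−γ}·(L^{−γ})^K`. [cite: King1986, Thm 3.4 (3.9) p.656, (3.10)–(3.11) p.656] -/
theorem kingVacuumSeq_succ_sub_le (hLodd : Odd L) (hL : 2 ≤ L) {a : ℝ} (ha : 0 < a) {m0sq : ℝ} (hm0 : 0 ≤ m0sq) :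
    ∃ A γ : ℝ, 1 ≤ A ∧ 0 < γ ∧ ∀ (msq : ℝ), 0 < msq → msq ≤ m0sq → ∀ (eM nn m : ℕ) (src tgt : Fin m → Fin (nn + 1)), (∀ v, LConn src tgt univ 0 v) →
      ∀ (κ : Fin m → Option (Fin (d + 1))), PosSubgraphsBy src tgt 0 ((d + 1 : ℕ) : ℝ) (fun ℓ => lineExp (d + 1) (κ ℓ)) →
      ∀ K : ℕ, |kingVacuumSeq L a msq eM nn m src tgt κ (K + 1) - kingVacuumSeq L a msq eM nn m src tgt κ K|
        ≤ (((2 * (L : ℝ) ^ eM) ^ (d + 1) * (L : ℝ) ^ (-γ) * (A ^ (2 * m + nn + 1) * ((m.factorial : ℝ) * (m + 1)))) * ((L : ℝ) ^ (-γ)) ^ K) := by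
  obtain ⟨A, γ, hA, hγ, H⟩ := king_vacuum_graph_rate_extensive (d := d) L hLodd hL ha hm0
  refine ⟨A, γ, hA, hγ, fun msq hm hcap eM nn m src tgt hconn κ hsub K => ?_⟩
  have key := H msq hm hcap (jvSucc (d := d) eM K) 1 le_rfl nn m src tgt hconn κ hsub
  haveI := kingVol_neZero L (jvSucc (d := d) eM K)
  have hcard : (Fintype.card (Tor (kingVol L (jvSucc (d := d) eM K))) : ℝ) = (2 * (L : ℝ) ^ eM) ^ (d + 1) := by
    rw [card_unitTorus]; push_cast; rfl
  have hpow : (L : ℝ) ^ (-(γ * ((jvSucc (d := d) eM K).K : ℕ))) = (L : ℝ) ^ (-γ) * ((L : ℝ) ^ (-γ)) ^ K := by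
    rw [show (-(γ * ((jvSucc (d := d) eM K).K : ℕ)) : ℝ) = (-γ) * ((K + 1 : ℕ) : ℝ) from by simp only [jvSucc]; ring,
      Real.rpow_mul (Nat.cast_nonneg L), Real.rpow_natCast, pow_succ, mul_comm]
  rw [hcard, hpow] at key
  calc _ = _ := rfl
    _ ≤ _ := key
    _ = _ := by ring

end Objects

/-! ## §2 Theorem 2.1 (i)–(ii)'s shapes for one vacuum diagram -/

section Limit

/-- ★★★ **THE `K → ∞` LIMIT OF A VACUUM DIAGRAM EXISTS, WITH THE RATE — THEOREM 2.1 (i) (2.22)'s SHAPE FOR ONE DIAGRAM, BY NAME AT `A = 0`.**  For odd `L ≥ 3`,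
`a > 0`, `m₀² ≥ 0` there are `A ≥ 1`, `γ > 0` such that for every mass `0 < m² ≤ m₀²`, volume exponent `e_M` and CONNECTED numbered vacuum graph under p. 664's
sentence there is `E^{(∞)}(G) ∈ ℝ` with `E^{(K+1)}(G) → E^{(∞)}(G)` (`K → ∞`) and, for every `K`,
`|E^{(K+1)}(G) − E^{(∞)}(G)| ≤ ((2L^{e_M})^{d+1}·L^{−γ}·A^{2m+nn+1}·m!·(m+1))·(L^{−γ})^K ∕ (1 − L^{−γ})` — «{E^{(K)}(G)} is a Cauchy sequence and converges to a unique
limit» ((3.13)), by §1 and Mathlib's `cauchySeq_of_le_geometric`. [cite: King1986, Thm 2.1 (i) (2.22) p.654, (3.10)–(3.13) pp.656–657, Thm 3.4 (3.9) p.656] -/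
theorem king_vacuum_graph_continuumLimit (hLodd : Odd L) (hL : 2 ≤ L) {a : ℝ} (ha : 0 < a) {m0sq : ℝ} (hm0 : 0 ≤ m0sq) :
    ∃ A γ : ℝ, 1 ≤ A ∧ 0 < γ ∧ ∀ (msq : ℝ), 0 < msq → msq ≤ m0sq → ∀ (eM nn m : ℕ) (src tgt : Fin m → Fin (nn + 1)), (∀ v, LConn src tgt univ 0 v) →
      ∀ (κ : Fin m → Option (Fin (d + 1))), PosSubgraphsBy src tgt 0 ((d + 1 : ℕ) : ℝ) (fun ℓ => lineExp (d + 1) (κ ℓ)) →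
      ∃ Einf : ℝ, Tendsto (kingVacuumSeq L a msq eM nn m src tgt κ) atTop (𝓝 Einf) ∧
        ∀ K : ℕ, |kingVacuumSeq L a msq eM nn m src tgt κ K - Einf|
          ≤ (((2 * (L : ℝ) ^ eM) ^ (d + 1) * (L : ℝ) ^ (-γ) * (A ^ (2 * m + nn + 1) * ((m.factorial : ℝ) * (m + 1)))) * ((L : ℝ) ^ (-γ)) ^ K)
              / (1 - (L : ℝ) ^ (-γ)) := by
  obtain ⟨A, γ, hA, hγ, H⟩ := kingVacuumSeq_succ_sub_le (d := d) L hLodd hL ha hm0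
  refine ⟨A, γ, hA, hγ, fun msq hm hcap eM nn m src tgt hconn κ hsub => ?_⟩
  have hL1r : (1 : ℝ) < L := by exact_mod_cast (show 1 < L by omega)
  have hr1 : (L : ℝ) ^ (-γ) < 1 := Real.rpow_lt_one_of_one_lt_of_neg hL1r (by linarith)
  set C : ℝ := (2 * (L : ℝ) ^ eM) ^ (d + 1) * (L : ℝ) ^ (-γ) * (A ^ (2 * m + nn + 1) * ((m.factorial : ℝ) * (m + 1))) with hC
  have hdist : ∀ K, dist (kingVacuumSeq L a msq eM nn m src tgt κ K) (kingVacuumSeq L a msq eM nn m src tgt κ (K + 1)) ≤ C * ((L : ℝ) ^ (-γ)) ^ K :=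
    fun K => by rw [Real.dist_eq, abs_sub_comm]; exact H msq hm hcap eM nn m src tgt hconn κ hsub K
  obtain ⟨Einf, hlim⟩ := cauchySeq_tendsto_of_complete (cauchySeq_of_le_geometric _ C hr1 hdist)
  refine ⟨Einf, hlim, fun K => ?_⟩
  rw [← Real.dist_eq]
  exact dist_le_of_le_geometric_of_tendsto _ C hr1 hdist hlim K

/-- ★★ **THE LIMIT IS EXTENSIVE — THEOREM 2.1 (ii) (2.23)'s SHAPE `≤ C|T|` FOR ONE DIAGRAM**: with part Β-a's size constant `A`, for every mass, volume exponent,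
CONNECTED vacuum graph with King's degrees positive along every ordering ((3.77)) and every limit point `E^{(∞)}` of the sequence `E^{(K+1)}(G)`:
`|E^{(∞)}(G)| ≤ (2L^{e_M})^{d+1}·A^{m+nn+1}·Σ_π degConst` (= `|T|·C_G`) — part Β-a `king_vacuum_graph_size_extensive` is uniform in `K`, and closed balls are closed
(`le_of_tendsto`). [cite: King1986, Thm 2.1 (ii) (2.23) p.654, (3.13) p.657 («the uniform bound … is just the statement of ultra-violet stability»), (3.77) p.666] -/
theorem king_vacuum_graph_limit_extensive (hLodd : Odd L) (hL : 2 ≤ L) {a : ℝ} (ha : 0 < a) {m0sq : ℝ} (hm0 : 0 ≤ m0sq) :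
    ∃ A : ℝ, 1 ≤ A ∧ ∀ (msq : ℝ), 0 < msq → msq ≤ m0sq → ∀ (eM nn m : ℕ) (src tgt : Fin m → Fin (nn + 1)), (∀ v, LConn src tgt univ 0 v) →
      ∀ (κ : Fin m → Option (Fin (d + 1))),
      (∀ π : Equiv.Perm (Fin m), PosDegrees (kingDegList src tgt ((d + 1 : ℕ) : ℝ) (fun ℓ => lineExp (d + 1) (κ ℓ)) π)) →
      ∀ Einf : ℝ, Tendsto (kingVacuumSeq L a msq eM nn m src tgt κ) atTop (𝓝 Einf) →
        |Einf| ≤ (2 * (L : ℝ) ^ eM) ^ (d + 1) * (A ^ (m + nn + 1)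
            * ∑ π : Equiv.Perm (Fin m), degConst L (kingDegList src tgt ((d + 1 : ℕ) : ℝ) (fun ℓ => lineExp (d + 1) (κ ℓ)) π)) := by
  obtain ⟨A, hA, H⟩ := king_vacuum_graph_size_extensive (d := d) L hLodd hL ha hm0
  refine ⟨A, hA, fun msq hm hcap eM nn m src tgt hconn κ hking Einf hlim => ?_⟩
  have hK : ∀ K, |kingVacuumSeq L a msq eM nn m src tgt κ K| ≤ (2 * (L : ℝ) ^ eM) ^ (d + 1) * (A ^ (m + nn + 1)
      * ∑ π : Equiv.Perm (Fin m), degConst L (kingDegList src tgt ((d + 1 : ℕ) : ℝ) (fun ℓ => lineExp (d + 1) (κ ℓ)) π)) := fun K => by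
    have key := H msq hm hcap (jvSucc (d := d) eM K) nn m src tgt hconn κ hking
    haveI := kingVol_neZero L (jvSucc (d := d) eM K)
    have hcard : (Fintype.card (Tor (kingVol L (jvSucc (d := d) eM K))) : ℝ) = (2 * (L : ℝ) ^ eM) ^ (d + 1) := by
      rw [card_unitTorus]; push_cast; rfl
    rw [hcard] at key
    exact key
  exact le_of_tendsto ((continuous_abs.tendsto Einf).comp hlim) (Eventually.of_forall hK)

end Limit

/-! ## §3 The hypothesis-free class: connected vacuum pseudoforests of `G`-lines, `1 ≤ d ≤ 3` -/

section Pseudoforest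

/-- ★★ **THE `K → ∞` LIMIT OF EVERY CONNECTED VACUUM PSEUDOFOREST OF `G`-LINES EXISTS, WITH THE RATE — NO HYPOTHESIS** (`1 ≤ d ≤ 3`; no tadpole, no parallel
pair: all connected trees and one-loop vacuum graphs): §2 with p. 664's sentence discharged by part Δ-c's counting.
[cite: King1986, Thm 2.1 (i) (2.22) p.654, (3.13) p.657, Prop. 3.6 (3.56) p.662, p.664] -/
theorem king_vacuum_pseudoforest_continuumLimit (hd1 : 1 ≤ d) (hd3 : d ≤ 3) (hLodd : Odd L) (hL : 2 ≤ L) {a : ℝ} (ha : 0 < a)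
    {m0sq : ℝ} (hm0 : 0 ≤ m0sq) :
    ∃ A γ : ℝ, 1 ≤ A ∧ 0 < γ ∧ ∀ (msq : ℝ), 0 < msq → msq ≤ m0sq → ∀ (eM nn m : ℕ) (src tgt : Fin m → Fin (nn + 1)), (∀ v, LConn src tgt univ 0 v) →
      (∀ ℓ, src ℓ ≠ tgt ℓ) → (∀ S : Finset (Fin m), S.card ≤ (lineVerts src tgt S).card) →
      (∀ S : Finset (Fin m), S.card = 2 → 3 ≤ (lineVerts src tgt S).card) →
      ∃ Einf : ℝ, Tendsto (kingVacuumSeq L a msq eM nn m src tgt (fun _ : Fin m => (none : Option (Fin (d + 1))))) atTop (𝓝 Einf) ∧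
        ∀ K : ℕ, |kingVacuumSeq L a msq eM nn m src tgt (fun _ : Fin m => (none : Option (Fin (d + 1)))) K - Einf|
          ≤ (((2 * (L : ℝ) ^ eM) ^ (d + 1) * (L : ℝ) ^ (-γ) * (A ^ (2 * m + nn + 1) * ((m.factorial : ℝ) * (m + 1)))) * ((L : ℝ) ^ (-γ)) ^ K)
              / (1 - (L : ℝ) ^ (-γ)) := by
  obtain ⟨A, γ, hA, hγ, H⟩ := king_vacuum_graph_continuumLimit (d := d) L hLodd hL ha hm0
  refine ⟨A, γ, hA, hγ, fun msq hm hcap eM nn m src tgt hconn h1 h2 h3 => ?_⟩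
  exact H msq hm hcap eM nn m src tgt hconn (fun _ => none) (posSubgraphsBy_lineExp_pseudoforest hd1 hd3 h1 h2 h3)

/-- ★★ **THE LIMIT OF A CONNECTED VACUUM PSEUDOFOREST IS EXTENSIVE — NO HYPOTHESIS** (`1 ≤ d ≤ 3`): §2's (2.23) shape with (3.77) discharged by part Α-p
`posDegrees_kingDegList_pseudoforest`. [cite: King1986, Thm 2.1 (ii) (2.23) p.654, (3.77) p.666] -/
theorem king_vacuum_pseudoforest_limit_extensive (hd1 : 1 ≤ d) (hd3 : d ≤ 3) (hLodd : Odd L) (hL : 2 ≤ L) {a : ℝ} (ha : 0 < a)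
    {m0sq : ℝ} (hm0 : 0 ≤ m0sq) :
    ∃ A : ℝ, 1 ≤ A ∧ ∀ (msq : ℝ), 0 < msq → msq ≤ m0sq → ∀ (eM nn m : ℕ) (src tgt : Fin m → Fin (nn + 1)), (∀ v, LConn src tgt univ 0 v) →
      (∀ ℓ, src ℓ ≠ tgt ℓ) → (∀ S : Finset (Fin m), S.card ≤ (lineVerts src tgt S).card) →
      (∀ S : Finset (Fin m), S.card = 2 → 3 ≤ (lineVerts src tgt S).card) →
      ∀ Einf : ℝ, Tendsto (kingVacuumSeq L a msq eM nn m src tgt (fun _ : Fin m => (none : Option (Fin (d + 1))))) atTop (𝓝 Einf) →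
        |Einf| ≤ (2 * (L : ℝ) ^ eM) ^ (d + 1) * (A ^ (m + nn + 1)
            * ∑ π : Equiv.Perm (Fin m), degConst L (kingDegList src tgt ((d + 1 : ℕ) : ℝ)
                (fun ℓ => lineExp (d + 1) ((fun _ : Fin m => (none : Option (Fin (d + 1)))) ℓ)) π)) := by
  obtain ⟨A, hA, H⟩ := king_vacuum_graph_limit_extensive (d := d) L hLodd hL ha hm0
  refine ⟨A, hA, fun msq hm hcap eM nn m src tgt hconn h1 h2 h3 Einf hlim => ?_⟩
  exact H msq hm hcap eM nn m src tgt hconn (fun _ => none) (posDegrees_kingDegList_pseudoforest hd1 hd3 h1 h2 h3) Einf hlim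

end Pseudoforest

end Summit.QuantumFields.YangMills.BalabanUVNodes.N15KingModelRung.Curved

end
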